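import Mathlib.MeasureTheory.Function.ConditionalExpectation.Real
import Mathlib.Probability.Process.Stopping
import Mathlib.Probability.Process.HittingTime
import HarnessLib

/-!
# Conditional expectation given a discrete observation: fibre averages, saturation

Topic `Literature/Probability/Process`; theorems only. Elementary facts about the σ-algebra
`σ(Y) = MeasurableSpace.comap Y ⊤` generated by an observation `Y : Ω → Z` with values in a set
`Z` carrying its discrete σ-algebra (the "first `n` steps of a lattice exploration", a list of
lattice sites), in the form consumed by the exploration filtrations of lattice interfaces
(Duminil-Copin–Smirnov, Clay Math. Proc. 15 (2012), Lemma 6.6: "`𝓕_n` generated by the first `n`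
steps of `γ`"; Chelkak–Duminil-Copin–Hongler–Kemppainen–Smirnov, C. R. Math. 352 (2014), §3):

* `measurableSet_comap_top_iff` — a set is `σ(Y)`-measurable iff it is saturated (a union of
  fibres of `Y`); `measurable_comap_top_of_forall_eq` — a map constant on the fibres of `Y` is
  `σ(Y)`-measurable; `apply_eq_of_measurable_comap_top` — conversely a `σ(Y)`-measurable map into
  a space with measurable points is constant on fibres; `comap_top_le_comap_top_of_forall_eq` —
  `σ(Y₁) ≤ σ(Y₂)` when `Y₁` factors through `Y₂` (monotonicity of exploration filtrations);
* `condExp_comap_top_apply_of_ne_zero` — **the conditional expectation given `σ(Y)` is the fibre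
  average** `E[X | σ(Y)](ω) = (∫_{Y = Y ω} X dμ) / μ(Y = Y ω)` at every point whose fibre has
  positive mass (finite measure, integrable `X`; no countability needed: `E[X | σ(Y)]` is constant
  on fibres and `∫_{fibre} E[X|σ(Y)] = ∫_{fibre} X`), and `condExp_comap_top_ae_eq` — hence a.e. on
  a countable space with measurable points (Williams, *Probability with Martingales* (1991), §9.1,
  "the elementary case"; Kallenberg (2021), Lemma 8.? — folklore);
* `measurable_stoppedSigma_of_saturated` — a map `f` is measurable for the stopped σ-algebra
  `𝒢_τ` of a discrete stopping time `τ` as soon as, for every `k`, the event `{τ = k}` and the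
  values of `f` on it are determined by an observation `Y k` generating (part of) `𝒢 k` (the
  shape "the driving values up to time `s` are determined by the first `σ` steps");
* `hittingBtwn_eq_of_forall_le_eq` — a first hitting index `< M` of a process is determined by
  the values of the process up to that index.

No definitions, no named facts; Mathlib only.

## References

* D. Williams, *Probability with Martingales*, CUP (1991), §9.1, §9.6.
* O. Kallenberg, *Foundations of Modern Probability*, 3rd ed. (2021), Ch. 8 (conditioning),
  Lemma 9.1 (`𝓕_τ`).
* H. Duminil-Copin, S. Smirnov, Clay Math. Proc. 15 (2012), Lemma 6.6.
-/

noncomputable section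

open MeasureTheory Filter Set
open scoped ENNReal

namespace Literature.Probability.Process

variable {Ω Z : Type*}

/-! ### The σ-algebra generated by a discrete observation -/

/-- A set is measurable for `σ(Y) = comap Y ⊤` iff it is saturated with respect to `Y` (a union
of fibres). [folklore] -/
theorem measurableSet_comap_top_iff (Y : Ω → Z) (s : Set Ω) :
    MeasurableSet[MeasurableSpace.comap Y ⊤] s ↔ ∀ ⦃a b : Ω⦄, Y a = Y b → a ∈ s → b ∈ s := by
  constructor
  · rintro ⟨B, -, rfl⟩ a b hab ha
    simp only [mem_preimage] at ha ⊢
    rwa [← hab]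
  · intro h
    refine ⟨Y '' s, MeasurableSpace.measurableSet_top, ?_⟩
    ext b
    constructor
    · rintro ⟨a, ha, hab⟩
      exact h hab ha
    · intro hb
      exact ⟨b, hb, rfl⟩

/-- A map constant on the fibres of `Y` is `σ(Y)`-measurable. [folklore] -/
theorem measurable_comap_top_of_forall_eq {β : Type*} [MeasurableSpace β] (Y : Ω → Z) {f : Ω → β}
    (h : ∀ ⦃a b : Ω⦄, Y a = Y b → f a = f b) : Measurable[MeasurableSpace.comap Y ⊤] f := by
  intro B _
  refine (measurableSet_comap_top_iff Y _).2 fun a b hab ha ↦ ?_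
  simp only [mem_preimage] at ha ⊢
  rwa [← h hab]

/-- A `σ(Y)`-measurable map into a space with measurable points is constant on the fibres of `Y`.
[folklore] -/
theorem apply_eq_of_measurable_comap_top {β : Type*} [MeasurableSpace β]
    [MeasurableSingletonClass β] {Y : Ω → Z} {f : Ω → β}
    (hf : Measurable[MeasurableSpace.comap Y ⊤] f) {a b : Ω} (hab : Y a = Y b) : f a = f b := by
  have hs := (measurableSet_comap_top_iff Y _).1 (hf (measurableSet_singleton (f a)))
  have hb : b ∈ f ⁻¹' {f a} := hs hab rfl
  exact (mem_singleton_iff.1 hb).symm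

/-- `σ(Y₁) ≤ σ(Y₂)` when `Y₁` is a function of `Y₂` (monotonicity of the filtration generated by
longer and longer initial segments of an exploration). [folklore] -/
theorem comap_top_le_comap_top_of_forall_eq {Z' : Type*} {Y₁ : Ω → Z} {Y₂ : Ω → Z'}
    (h : ∀ ⦃a b : Ω⦄, Y₂ a = Y₂ b → Y₁ a = Y₁ b) :
    MeasurableSpace.comap Y₁ ⊤ ≤ MeasurableSpace.comap Y₂ ⊤ := by
  intro s hs
  exact (measurableSet_comap_top_iff Y₂ s).2 fun a b hab ↦
    (measurableSet_comap_top_iff Y₁ s).1 hs (h hab)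

/-- Fibres of `Y` are `σ(Y)`-measurable. [folklore] -/
theorem measurableSet_comap_top_fibre (Y : Ω → Z) (z : Z) :
    MeasurableSet[MeasurableSpace.comap Y ⊤] (Y ⁻¹' {z}) :=
  ⟨{z}, MeasurableSpace.measurableSet_top, rfl⟩

/-! ### The conditional expectation given a discrete observation is the fibre average -/

variable {mΩ : MeasurableSpace Ω} {μ : Measure Ω}

/-- **`E[X | σ(Y)]` is the fibre average on every fibre of positive mass**: for a finite measure,
an integrable real `X` and `σ(Y) ≤` the ambient σ-algebra,
`E[X | σ(Y)](ω) = (μ(Y = Y ω))⁻¹ ∫_{Y = Y ω} X dμ` whenever `μ(Y = Y ω) ≠ 0` (the elementary case of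
conditioning; `E[X|σ(Y)]` is constant on the fibre and has the same integral over it as `X`).
[folklore] -/
theorem condExp_comap_top_apply_of_ne_zero [IsFiniteMeasure μ] {Y : Ω → Z}
    (hle : MeasurableSpace.comap Y ⊤ ≤ mΩ) {X : Ω → ℝ} (hX : Integrable X μ) {ω : Ω}
    (hω : μ (Y ⁻¹' {Y ω}) ≠ 0) :
    μ[X | MeasurableSpace.comap Y ⊤] ω =
      (μ.real (Y ⁻¹' {Y ω}))⁻¹ * ∫ x in Y ⁻¹' {Y ω}, X x ∂μ := by
  have hC : MeasurableSet[MeasurableSpace.comap Y ⊤] (Y ⁻¹' {Y ω}) :=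
    measurableSet_comap_top_fibre Y (Y ω)
  have h1 : ∫ x in Y ⁻¹' {Y ω}, (μ[X | MeasurableSpace.comap Y ⊤]) x ∂μ =
      ∫ x in Y ⁻¹' {Y ω}, X x ∂μ := setIntegral_condExp hle hX hC
  have hconst : ∀ x ∈ Y ⁻¹' {Y ω},
      (μ[X | MeasurableSpace.comap Y ⊤]) x = (μ[X | MeasurableSpace.comap Y ⊤]) ω := fun x hx ↦
    apply_eq_of_measurable_comap_top stronglyMeasurable_condExp.measurable
      (mem_singleton_iff.1 (mem_preimage.1 hx))
  have h2 : ∫ x in Y ⁻¹' {Y ω}, (μ[X | MeasurableSpace.comap Y ⊤]) x ∂μ =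
      μ.real (Y ⁻¹' {Y ω}) * (μ[X | MeasurableSpace.comap Y ⊤]) ω := by
    rw [setIntegral_congr_fun (hle _ hC) hconst, setIntegral_const, smul_eq_mul]
  have hC0 : μ.real (Y ⁻¹' {Y ω}) ≠ 0 := by
    rw [measureReal_def, ENNReal.toReal_ne_zero]
    exact ⟨hω, measure_ne_top _ _⟩
  rw [h2] at h1
  field_simp
  linarith

/-- **A.e. form on a countable space with measurable points**: `E[X | σ(Y)]` equals the fibre
average `μ`-almost everywhere (the fibres of zero mass form a null set). [folklore] -/
theorem condExp_comap_top_ae_eq [Countable Ω] [MeasurableSingletonClass Ω] [IsFiniteMeasure μ]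
    {Y : Ω → Z} (hle : MeasurableSpace.comap Y ⊤ ≤ mΩ) {X : Ω → ℝ} (hX : Integrable X μ) :
    μ[X | MeasurableSpace.comap Y ⊤] =ᵐ[μ]
      fun ω ↦ (μ.real (Y ⁻¹' {Y ω}))⁻¹ * ∫ x in Y ⁻¹' {Y ω}, X x ∂μ := by
  have hnull : μ {ω | μ (Y ⁻¹' {Y ω}) = 0} = 0 := by
    have hsub : {ω | μ (Y ⁻¹' {Y ω}) = 0} ⊆ ⋃ ω ∈ {ω | μ (Y ⁻¹' {Y ω}) = 0}, Y ⁻¹' {Y ω} :=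
      fun ω hω ↦ mem_biUnion hω rfl
    refine measure_mono_null hsub ?_
    exact (measure_biUnion_null_iff (Set.to_countable _)).2 fun ω hω ↦ hω
  rw [Filter.EventuallyEq, ae_iff]
  refine measure_mono_null (fun ω hω ↦ ?_) hnull
  by_contra hne
  exact hω (condExp_comap_top_apply_of_ne_zero hle hX hne)

/-! ### Measurability for the stopped σ-algebra of a discrete exploration -/

/-- **Measurability for `𝒢_τ` by saturation.** Let `𝒢` be a filtration on `ℕ`, `τ` a
`𝒢`-stopping time and `Y k : Ω → Z` observations such that every `Y k`-saturated set is
`𝒢 k`-measurable. If for every `k` the event `{τ = k}` is `Y k`-saturated and `f` is constant on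
the `Y k`-fibres inside `{τ = k}`, then the (measurable) map `f` is measurable for the stopped
σ-algebra `𝒢_τ` (`IsStoppingTime.measurableSpace`). This is the form in which "the driving values
at times `≤ s` are determined by the exploration up to its first step of capacity `≥ s`" is used
(CDHKS 2014, §3). [folklore] -/
theorem measurable_stoppedSigma_of_saturated {m : MeasurableSpace Ω} {𝒢 : Filtration ℕ m}
    {τ : Ω → WithTop ℕ} (hτ : IsStoppingTime 𝒢 τ) {β : Type*} [MeasurableSpace β] {f : Ω → β}
    (hf : Measurable f) (Y : ℕ → Ω → Z)
    (h𝒢 : ∀ (k : ℕ) (s : Set Ω), (∀ ⦃a b : Ω⦄, Y k a = Y k b → a ∈ s → b ∈ s) →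
      MeasurableSet[𝒢 k] s)
    (hτY : ∀ (k : ℕ) ⦃a b : Ω⦄, τ a = k → Y k a = Y k b → τ b = k)
    (hfY : ∀ (k : ℕ) ⦃a b : Ω⦄, τ a = k → Y k a = Y k b → f a = f b) :
    Measurable[hτ.measurableSpace] f := by
  intro B hB
  refine ⟨hf hB, fun i ↦ ?_⟩
  have key : MeasurableSet[𝒢 i] (⋃ k ∈ Set.Iic i, (f ⁻¹' B ∩ {ω | τ ω = k})) := by
    refine MeasurableSet.biUnion (Set.to_countable _) fun k hk ↦
      𝒢.mono hk _ (h𝒢 k _ fun a b hab ha ↦ ?_)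
    simp only [mem_inter_iff, mem_preimage, mem_setOf_eq] at ha ⊢
    exact ⟨by rw [← hfY k ha.2 hab]; exact ha.1, hτY k ha.2 hab⟩
  convert key using 1
  ext ω
  simp only [mem_inter_iff, mem_preimage, mem_setOf_eq, mem_iUnion, mem_Iic, exists_prop]
  constructor
  · rintro ⟨hω, hle⟩
    have hne : τ ω ≠ ⊤ := ne_top_of_le_ne_top WithTop.coe_ne_top hle
    obtain ⟨k, hk⟩ := WithTop.ne_top_iff_exists.1 hne
    refine ⟨k, ?_, hω, hk.symm⟩
    rw [← hk] at hle
    exact WithTop.coe_le_coe.1 hle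
  · rintro ⟨k, hk, hω, hτk⟩
    exact ⟨hω, by rw [hτk]; exact WithTop.coe_le_coe.2 hk⟩

/-- **A first hitting index is determined by the past.** If two sample points have the same
values of the process `u` up to index `k`, and the first hitting index (between `0` and `M`) of
the set `s` by `u` at the first point is `k < M`, then it is `k` at the second point too.
[folklore] -/
theorem hittingBtwn_eq_of_forall_le_eq {β : Type*} {u : ℕ → Ω → β} {s : Set β} {M k : ℕ}
    {a b : Ω} (hu : ∀ j ≤ k, u j a = u j b) (ha : hittingBtwn u s 0 M a = k) (hk : k < M) :
    hittingBtwn u s 0 M b = k := by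
  have hmem : u k a ∈ s := by
    have h := hittingBtwn_mem_set_of_hittingBtwn_lt (u := u) (s := s) (n := 0) (m := M) (ω := a)
      (by rw [ha]; exact hk)
    rwa [ha] at h
  have hkb : u k b ∈ s := by rwa [hu k le_rfl] at hmem
  refine le_antisymm (hittingBtwn_le_of_mem (Nat.zero_le _) hk.le hkb) ?_
  by_contra hlt
  rw [not_le] at hlt
  have hbm : u (hittingBtwn u s 0 M b) b ∈ s := hittingBtwn_mem_set_of_hittingBtwn_lt (hlt.trans hk)
  rw [← hu _ hlt.le] at hbm
  have hle : hittingBtwn u s 0 M a ≤ hittingBtwn u s 0 M b :=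
    hittingBtwn_le_of_mem (Nat.zero_le _) (hittingBtwn_le b) hbm
  rw [ha] at hle
  exact absurd (hle.trans_lt hlt) (lt_irrefl _)

end Literature.Probability.Process

end
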